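import Literature.Analysis.FluidPDE.HarmonicLiouvilleLp
import HarnessLib

/-!
# Liouville's theorem for harmonic functions with sub-volume `L²`-growth

Analysis/FluidPDE support file (theorems only).  Let `E` be a finite-dimensional real inner product space of dimension
`d ≥ 1` with its Lebesgue measure.  MAIN THEOREM:

* `InnerProductSpace.HarmonicOnNhd.eq_zero_of_setIntegral_sq_le` — a function `η` harmonic on all of `E` with
  `∫_{B(0,L)} η² ≤ C L^θ` for all `L > 0`, where `θ < d`, VANISHES IDENTICALLY;
* `InnerProductSpace.HarmonicOnNhd.eq_zero_of_lintegral_sq_le` — the same with the hypothesis in `ℝ≥0∞` form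
  (`∫⁻_{B(0,L)} ‖η‖ₑ² ≤ C · ofReal (L^θ)`, `C < ∞`), the shape in which scaled energy bounds occur in the tree
  (e.g. the profile energy growth `∫_{B_L}‖V‖² ≤ c L^{1−2ρ}` of Chae–Shvydkoy 2013 (1.3) in the crux
  `EulerZoomLiouville.PowerGaugeEulerLiouville` of `Summits/NavierStokesRegularity`).

Proof (Gilbarg–Trudinger, Thm 2.1: the mean value inequality, here in the tree's form
`abs_le_inv_mul_setIntegral_of_harmonic`: `|η(y)| ≤ (m R^d)⁻¹ ∫_{B̄(y,2R)} |η|`): by the elementary inequality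
`|a| ≤ t/2 + a²/(2t)` (`t > 0`), `∫_{B̄(y,2R)} |η| ≤ (t/2)|B̄(y,2R)| + (2t)⁻¹ ∫_{B(0,4R)} η² ≤ (t/2)(2R)^d|B̄₁| + (2t)⁻¹ C (4R)^θ`
for `R ≥ ‖y‖ + 1`; the choice `t = R^{−(d−θ)/2}` gives `|η(y)| ≤ K R^{−(d−θ)/2} → 0`.  The exponent `θ < d` is sharp
(constants have `θ = d`).  This is the growth form of Liouville's theorem (a harmonic function whose `L²`-mass in balls
grows slower than the volume is zero); compare the tree's bounded, sublinear-growth and `L^p` versions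
(`HarmonicOnNhd.apply_eq_apply_of_abs_le`, `.apply_eq_apply_of_sublinear`, `.eq_zero_of_memLp`).

## References

* D. Gilbarg, N. S. Trudinger, *Elliptic Partial Differential Equations of Second Order* (Springer, 2001 reprint),
  Thm 2.1 (mean value property) and the Liouville theorem that follows from it. [GilbargTrudinger2001]
-/

noncomputable section

open MeasureTheory TopologicalSpace Set Function Filter InnerProductSpace Metric
open _root_.Topology
open scoped RealInnerProductSpace ENNReal NNReal

namespace Literature.Analysis.FluidPDE

variable {E : Type*} [NormedAddCommGroup E] [InnerProductSpace ℝ E] [FiniteDimensional ℝ E]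
  [MeasurableSpace E] [BorelSpace E]

/-- The elementary inequality `|a| ≤ t/2 + a²/(2t)` for `t > 0` (from `(|a| − t)² ≥ 0`). [folklore] -/
private theorem abs_le_half_add_sq_div (a : ℝ) {t : ℝ} (ht : 0 < t) : |a| ≤ t / 2 + a ^ 2 / (2 * t) := by
  have key : 2 * t * |a| ≤ t ^ 2 + a ^ 2 := by nlinarith [sq_nonneg (|a| - t), sq_abs a]
  have h1 : t / 2 + a ^ 2 / (2 * t) = (t ^ 2 + a ^ 2) / (2 * t) := by
    field_simp
  rw [h1, le_div_iff₀ (by positivity)]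
  linarith

/-- **Liouville's theorem, growth form (real integrals).**  A function harmonic on all of `E` (`dim E = d ≥ 1`) with
`∫_{B(0,L)} η² ≤ C L^θ` for every `L > 0`, where `θ < d`, vanishes identically: the mean value inequality over
`B̄(y, 2R)` and `|a| ≤ t/2 + a²/(2t)` with `t = R^{−(d−θ)/2}` give `|η(y)| ≤ K R^{−(d−θ)/2} → 0`.
[cite: GilbargTrudinger2001, Thm 2.1] -/
theorem _root_.InnerProductSpace.HarmonicOnNhd.eq_zero_of_setIntegral_sq_le [Nontrivial E] {η : E → ℝ}
    (hη : HarmonicOnNhd η univ) {C θ : ℝ} (hθ : θ < Module.finrank ℝ E)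
    (hA : ∀ L : ℝ, 0 < L → ∫ x in ball (0 : E) L, η x ^ 2 ≤ C * L ^ θ) (y : E) : η y = 0 := by
  set d : ℕ := Module.finrank ℝ E with hd_def
  have hd : 0 < d := Module.finrank_pos
  have hηc : Continuous η := (contDiff_two_of_harmonicOnNhd_univ hη).continuous
  set m : ℝ := baseBumpMass E with hm_def
  have hm : 0 < m := baseBumpMass_pos
  set V₁ : ℝ := (volume : Measure E).real (closedBall (0 : E) 1) with hV₁_def
  have hV₁ : 0 ≤ V₁ := measureReal_nonneg
  -- the decay exponent `s = (d − θ)/2 > 0`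
  set s : ℝ := ((d : ℝ) - θ) / 2 with hs_def
  have hs : 0 < s := by rw [hs_def]; linarith
  set K : ℝ := m⁻¹ * ((2 : ℝ) ^ d * V₁ / 2 + C * (4 : ℝ) ^ θ / 2) with hK_def
  -- ### the key estimate for every large radius
  have key : ∀ R : ℝ, ‖y‖ + 1 ≤ R → |η y| ≤ K * R ^ (-s) := by
    intro R hyR
    have hR : 0 < R := by linarith [norm_nonneg y]
    have hR1 : 1 ≤ R := by linarith [norm_nonneg y]
    set t : ℝ := R ^ (-s) with ht_def
    have ht : 0 < t := Real.rpow_pos_of_pos hR _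
    set S : Set E := closedBall y (2 * R) with hS_def
    have hSc : IsCompact S := isCompact_closedBall _ _
    -- mean value inequality
    have h1 := abs_le_inv_mul_setIntegral_of_harmonic hη hR y
    -- integrability on `S`
    have hIabs : IntegrableOn (fun w => |η w|) S volume := hηc.abs.continuousOn.integrableOn_compact hSc
    have hIsq : IntegrableOn (fun w => η w ^ 2) S volume := (hηc.pow 2).continuousOn.integrableOn_compact hSc
    have hIrhs : IntegrableOn (fun w => t / 2 + η w ^ 2 / (2 * t)) S volume :=
      (continuous_const.add ((hηc.pow 2).div_const _)).continuousOn.integrableOn_compact hSc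
    -- `∫_S |η| ≤ (t/2) |S| + (2t)⁻¹ ∫_S η²`
    have h2 : ∫ w in S, |η w| ≤ t / 2 * (volume : Measure E).real S + (∫ w in S, η w ^ 2) / (2 * t) := by
      calc ∫ w in S, |η w| ≤ ∫ w in S, (t / 2 + η w ^ 2 / (2 * t)) :=
            setIntegral_mono_on hIabs hIrhs measurableSet_closedBall fun w _ => abs_le_half_add_sq_div (η w) ht
        _ = (∫ w in S, t / 2) + ∫ w in S, η w ^ 2 / (2 * t) :=
            integral_add (continuous_const.continuousOn.integrableOn_compact hSc) (hIsq.div_const _)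
        _ = t / 2 * (volume : Measure E).real S + (∫ w in S, η w ^ 2) / (2 * t) := by
            rw [setIntegral_const, smul_eq_mul, mul_comm, integral_div]
    -- volume of the ball and the growth hypothesis on `B(0, 4R) ⊇ S`
    have h3 : (volume : Measure E).real S = (2 * R) ^ d * V₁ := by
      rw [hS_def, hV₁_def, Measure.addHaar_real_closedBall' volume y (by positivity)]
    have hSsub : S ⊆ ball (0 : E) (4 * R) := by
      intro w hw
      rw [hS_def, mem_closedBall, dist_eq_norm] at hw
      rw [mem_ball_zero_iff]
      calc ‖w‖ = ‖(w - y) + y‖ := by rw [sub_add_cancel]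
        _ ≤ ‖w - y‖ + ‖y‖ := norm_add_le _ _
        _ < 4 * R := by linarith
    have hIball : IntegrableOn (fun w => η w ^ 2) (ball (0 : E) (4 * R)) volume :=
      ((hηc.pow 2).continuousOn.integrableOn_compact (isCompact_closedBall (0 : E) (4 * R))).mono_set
        ball_subset_closedBall
    have h4 : ∫ w in S, η w ^ 2 ≤ C * (4 * R) ^ θ :=
      (setIntegral_mono_set hIball (Eventually.of_forall fun w => sq_nonneg (η w)) (Eventually.of_forall hSsub)).trans
        (hA (4 * R) (by positivity))
    -- assemble
    have hRd : (0 : ℝ) < R ^ d := pow_pos hR d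
    have hmRd : 0 < m * R ^ d := mul_pos hm hRd
    have h5 : |η y| ≤ (m * R ^ d)⁻¹ * (t / 2 * ((2 * R) ^ d * V₁) + C * (4 * R) ^ θ / (2 * t)) := by
      refine h1.trans (mul_le_mul_of_nonneg_left ?_ (inv_nonneg.2 hmRd.le))
      rw [← h3]
      exact h2.trans (by gcongr)
    -- exponent bookkeeping: `t R^d = R^{d−s}`, `R^θ / t = R^{θ+s}`, and `d − s = θ + s = d − s`
    have hRdr : (R : ℝ) ^ d = R ^ (d : ℝ) := (Real.rpow_natCast R d).symm
    have e1 : t / 2 * ((2 * R) ^ d * V₁) = (2 : ℝ) ^ d * V₁ / 2 * R ^ ((d : ℝ) - s) := by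
      rw [mul_pow, hRdr, ht_def, show (d : ℝ) - s = -s + d by ring, Real.rpow_add hR]
      ring
    have e2 : C * (4 * R) ^ θ / (2 * t) = C * (4 : ℝ) ^ θ / 2 * R ^ (θ + s) := by
      rw [Real.mul_rpow (by norm_num) hR.le, ht_def, Real.rpow_add hR, Real.rpow_neg hR.le]
      field_simp
    have e3 : (d : ℝ) - s = θ + s := by rw [hs_def]; ring
    have e4 : (m * R ^ d)⁻¹ * R ^ (θ + s) = m⁻¹ * R ^ (-s) := by
      rw [hRdr, mul_inv, mul_assoc, ← Real.rpow_neg hR.le, ← Real.rpow_add hR]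
      congr 2
      rw [hs_def]; ring
    calc |η y| ≤ (m * R ^ d)⁻¹ * (t / 2 * ((2 * R) ^ d * V₁) + C * (4 * R) ^ θ / (2 * t)) := h5
      _ = (m * R ^ d)⁻¹ * R ^ (θ + s) * ((2 : ℝ) ^ d * V₁ / 2 + C * (4 : ℝ) ^ θ / 2) := by
          rw [e1, e2, e3]; ring
      _ = K * R ^ (-s) := by rw [e4, hK_def]; ring
  -- ### let `R → ∞`
  have hlim : Tendsto (fun R : ℝ => K * R ^ (-s)) atTop (𝓝 0) := by
    have := (tendsto_rpow_neg_atTop hs).const_mul K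
    rwa [mul_zero] at this
  have hle : |η y| ≤ 0 :=
    ge_of_tendsto hlim (Filter.eventually_atTop.2 ⟨‖y‖ + 1, fun R hR => key R hR⟩)
  exact abs_nonpos_iff.1 hle

/-- **Liouville's theorem, growth form (`ℝ≥0∞` hypothesis).**  A function harmonic on all of `E` (`dim E = d ≥ 1`) with
`∫⁻_{B(0,L)} ‖η‖ₑ² ≤ C · ofReal (L^θ)` for every `L > 0`, where `C < ∞` and `θ < d`, vanishes identically.
[cite: GilbargTrudinger2001, Thm 2.1] -/
theorem _root_.InnerProductSpace.HarmonicOnNhd.eq_zero_of_lintegral_sq_le [Nontrivial E] {η : E → ℝ}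
    (hη : HarmonicOnNhd η univ) {C : ℝ≥0∞} (hC : C ≠ ⊤) {θ : ℝ} (hθ : θ < Module.finrank ℝ E)
    (hA : ∀ L : ℝ, 0 < L → ∫⁻ x in ball (0 : E) L, ‖η x‖ₑ ^ 2 ≤ C * ENNReal.ofReal (L ^ θ)) (y : E) :
    η y = 0 := by
  have hηc : Continuous η := (contDiff_two_of_harmonicOnNhd_univ hη).continuous
  refine hη.eq_zero_of_setIntegral_sq_le (C := C.toReal) hθ (fun L hL => ?_) y
  have hmeas : AEStronglyMeasurable (fun x => η x ^ 2) (volume.restrict (ball (0 : E) L)) :=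
    (hηc.pow 2).aestronglyMeasurable
  rw [integral_eq_lintegral_of_nonneg_ae (Eventually.of_forall fun x => sq_nonneg (η x)) hmeas]
  have hconv : ∫⁻ x in ball (0 : E) L, ENNReal.ofReal (η x ^ 2) = ∫⁻ x in ball (0 : E) L, ‖η x‖ₑ ^ 2 := by
    refine lintegral_congr fun x => ?_
    rw [Real.enorm_eq_ofReal_abs, ← ENNReal.ofReal_pow (abs_nonneg _), sq_abs]
  rw [hconv]
  have hfin : C * ENNReal.ofReal (L ^ θ) ≠ ⊤ := ENNReal.mul_ne_top hC ENNReal.ofReal_ne_top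
  calc (∫⁻ x in ball (0 : E) L, ‖η x‖ₑ ^ 2).toReal ≤ (C * ENNReal.ofReal (L ^ θ)).toReal :=
        ENNReal.toReal_mono hfin (hA L hL)
    _ = C.toReal * L ^ θ := by rw [ENNReal.toReal_mul, ENNReal.toReal_ofReal (Real.rpow_nonneg hL.le _)]

end Literature.Analysis.FluidPDE

end
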